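import Summits.QuantumFields.BalabanUV.Beta.TubeZeroFreeSymmetry

/-!
# Beta / CapRouteABoxes — ROUTE A'S ANCHOR IN CERTIFICATE CURRENCY: one quarter-region BOX COVER + compass WORDS for `k₀`, nothing else
# analytic (β sub-cell, BINDER-OWNERS row CAP-k, lineage `b2b-balaban-beta-an5`, gen 23; node BETA-an5-g23-THEOREM-DB, END; journal CLAIM l.14161)

THE ROW'S TYPED TARGET AFTER THEOREM DB, as ONE signature for the β-row's actual shape `A′ = k₀(· − c)` with a REAL external momentum `c`
(`TubeHolAlgebra` §3: «REAL on the β-row»): `rowsOfOneLoopFormCode16E_routeA₂_ofBoxesRealShift`.  Its binders by kind —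
(N) `hb` the level-0 dictionary (row D1); STRUCTURE `MatTubeHol` for `A`, `A(· − c)`, `B`, `C`, `D` at width `κ` (automatic for character sums:
`matTubeHol_characterSum(_sub)`) and the two TABLE SYMMETRIES `MatNegTranspose A` (`K₀[−R] = K₀[R]ᵀ`), `MatConjSymm A` (real tables);
(Z2a)+(Z1-F) ONE FINITE BOX COVER of the quarter region `{Im q_{ν₀} = +κ, Re q_{ν₁} ≤ 0}` of the vertex tori with per-leaf certificates
`IsUnit (A q).det ∧ ‖(A q)⁻¹‖ ≤ Ba` (order-0 `ResolventBoxCertificate.box_certificate` or order-m `ResolventBoxCertificateTaylor.box_certificate_taylor`);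
(Z1-W) one `SliceWindingEq (det ∘ A)` per coordinate × sign pattern (pairs of closed compass words, `TubeZeroFreeEnds.sliceWindingEq_of_words`; 6 after
`TubeZeroFreeSymmetry`); (Z2b) stencil sups `hSst hSs hSt`; (T) the two-engine ball `hT`; (A) `hA₀` with `M := |n|·(Ba·S_st + Ba·S_s·Ba·S_t)`; cmp `hlo`.
EVERYTHING for the shifted family — its (Z1) binder and its resolvent bound — is DERIVED from `A`'s data by periodicity (§1).

* §1 `MatTubeHol.apply_reduceRe`, `invNorm_le_allCircles_of_vertexTori`, `invNorm_sub_real_le_of_vertexTori` (a vertex-tori bound of `‖A⁻¹‖`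
  holds at every point with all `|Im q_μ| = w_μ`, hence for `A(· − c)` on the vertex tori when `Im c = 0`).
* §2 the anchor `rowsOfOneLoopFormCode16E_routeA₂_ofBoxesRealShift` (= `CapRouteA.rowsOfOneLoopFormCode16E_routeA₂` with `a = κ`, `A′ := A(· − c)`,
  `hdet hdet′ hBa hBa′` DISCHARGED); its `Rows b` feeds `CapRows.betaAvgAFH_of_capRows` as every anchor of the row does.

HONEST FRAMING.  Kernel glue: ONE constructor application over gen 21–23's modules; no box, no word, no number supplied; 0 binders instantiated.
Discharging `BetaPertH` would make Bałaban's ultraviolet stability unconditional — NOT the continuum limit, NOT the Clay problem.  0 `sorry`, 0 cite tags.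
-/

namespace Summit.QuantumFields.BalabanUV.Beta.CapRouteABoxes

open Complex Set Matrix
open Literature.MathematicalPhysics.QuantumFieldTheory.Balaban1983to89
open B4Strip (Strip)
open B4ContourShift (latticeKernel)
open B4TorusKernel (descend gridPt)
open Beta.AliasingTailL1 (aliasRatioL1)
open Beta.AliasingTailLattice (codeTheta code16SetE)
open Summit.QuantumFields.BalabanUV.Beta.CapRows (Rows)
open Summit.QuantumFields.BalabanUV.Beta.TubeMaximumModulus
open Summit.QuantumFields.BalabanUV.Beta.VertexToriSymmetry
open Summit.QuantumFields.BalabanUV.Beta.ConjReflectionAlgebra (MatConjSymm)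
open Summit.QuantumFields.BalabanUV.Beta.ResolventBoxCertificate (Box hBa_of_boxes_negConjRegion)
open Summit.QuantumFields.BalabanUV.Beta.TubeZeroFreeEnds
open Summit.QuantumFields.BalabanUV.Beta.TubeZeroFreeSymmetry
open Summit.QuantumFields.BalabanUV.Beta.CapRouteA (rowsOfOneLoopFormCode16E_routeA₂)
open scoped Real Matrix.Norms.L2Operator

noncomputable section

variable {d : ℕ} {n : Type*} [Fintype n] [DecidableEq n]

/-! ## §1 All-circles transport of a vertex-tori resolvent bound; the real-shifted family -/

omit [Fintype n] [DecidableEq n] in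
/-- a tube-holomorphic matrix family takes the same value at a point and at its periodic reduction. [folklore] -/
theorem _root_.Summit.QuantumFields.BalabanUV.Beta.TubeMaximumModulus.MatTubeHol.apply_reduceRe
    {A : (Fin (d + 1) → ℂ) → Matrix n n ℂ} {w : Fin (d + 1) → ℝ} (hA : MatTubeHol A w) (p : Fin (d + 1) → ℂ) :
    A (reduceRe p) = A p := by
  ext i j
  exact (hA i j).apply_reduceRe p

/-- a bound of `‖A⁻¹‖` on the vertex tori holds at EVERY point with all `|Im q_μ| = w_μ` (all real parts). [folklore] -/
theorem invNorm_le_allCircles_of_vertexTori {A : (Fin (d + 1) → ℂ) → Matrix n n ℂ} {w : Fin (d + 1) → ℝ} (hA : MatTubeHol A w)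
    {B : ℝ} (hBa : ∀ p ∈ VertexTori w, ‖(A p)⁻¹‖ ≤ B) :
    ∀ p : Fin (d + 1) → ℂ, (∀ μ, |(p μ).im| = w μ) → ‖(A p)⁻¹‖ ≤ B := fun p hp => by
  rw [← hA.apply_reduceRe p]; exact hBa _ (reduceRe_mem_vertexTori hp)

/-- THE REAL-SHIFTED FAMILY `q ↦ A (q − c)`, `Im c_μ = 0`: its resolvent bound on the vertex tori is that of `A`. [folklore] -/
theorem invNorm_sub_real_le_of_vertexTori {A : (Fin (d + 1) → ℂ) → Matrix n n ℂ} {w : Fin (d + 1) → ℝ} (hA : MatTubeHol A w)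
    {B : ℝ} (hBa : ∀ p ∈ VertexTori w, ‖(A p)⁻¹‖ ≤ B) {c : Fin (d + 1) → ℂ} (hc : ∀ μ, (c μ).im = 0) :
    ∀ p ∈ VertexTori w, ‖(A (p - c))⁻¹‖ ≤ B := fun p hp =>
  invNorm_le_allCircles_of_vertexTori hA hBa (p - c) fun μ => by rw [Pi.sub_apply, sub_im, hc μ, sub_zero]; exact (hp μ).2

/-! ## §2 The anchor in certificate currency -/

section Anchor

variable {b : ℕ → ℝ} {A B C D : (Fin 4 → ℂ) → Matrix n n ℂ} {κ Ba Sst Ss St : ℝ} {c : Fin 4 → ℂ}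

/-- **ROUTE A'S ANCHOR IN CERTIFICATE CURRENCY** (β-row shape `A′ = A(· − c)`, `Im c = 0`).  Data: (N) `hb`; STRUCTURE `MatTubeHol` ×5 at width `κ`
and the table symmetries `MatNegTranspose A`, `MatConjSymm A`; ONE quarter-region box cover `(boxes, ctr, hw, hcov, hcert)` of the vertex tori
`|Im q_μ| = κ` with per-leaf certificates `IsUnit (A q).det ∧ ‖(A q)⁻¹‖ ≤ Ba`; the (W) data `hW` for `det ∘ A`; (Z2b) `hSst hSs hSt`; (T) `hT`;
(A) `hA₀`; cmp `hlo`.  THEN `Rows b` — with `hdet`, `hdet′`, `hBa`, `hBa′` of `CapRouteA.rowsOfOneLoopFormCode16E_routeA₂` ALL DISCHARGED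
(THEOREM DB + `det_ne_zero_vertexTori_of_boxes_negConjRegion` + `hBa_of_boxes_negConjRegion` + periodicity for the shift). [folklore] -/
def rowsOfOneLoopFormCode16E_routeA₂_ofBoxesRealShift
    (hb : b 0 = (latticeKernel (fun p => ((A p)⁻¹ * B p).trace - ((A p)⁻¹ * C p * (A (p - c))⁻¹ * D p).trace) 0).re)
    (hκ : 0 < κ) (hc : ∀ μ, (c μ).im = 0)
    (hA : MatTubeHol A (fun _ => κ)) (hA' : MatTubeHol (fun p => A (p - c)) (fun _ => κ))
    (hBst : MatTubeHol B (fun _ => κ)) (hBs : MatTubeHol C (fun _ => κ)) (hBt : MatTubeHol D (fun _ => κ))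
    (hAn : MatNegTranspose A) (hAc : MatConjSymm A)
    (ν₀ ν₁ : Fin (3 + 1)) {ι : Type*} (boxes : Finset ι) (ctr : ι → Fin (3 + 1) → ℂ) (hw : ι → Fin (3 + 1) → ℝ)
    (hcov : ∀ q ∈ VertexTori (fun _ : Fin (3 + 1) => κ), (q ν₀).im = κ → (q ν₁).re ≤ 0 → ∃ bx ∈ boxes, q ∈ Box (ctr bx) (hw bx))
    (hcert : ∀ bx ∈ boxes, ∀ q ∈ Box (ctr bx) (hw bx), IsUnit (A q).det ∧ ‖(A q)⁻¹‖ ≤ Ba)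
    (hW : ∀ (i : Fin (3 + 1)) (s : Fin 3 → ℝ), (∀ j, s j = 1 ∨ s j = -1) →
      ∃ q₀ : Fin 3 → ℂ, (∀ j, (q₀ j).im = s j * κ) ∧ SliceWindingEq (fun p => (A p).det) (fun _ => κ) i q₀)
    (hSst : ∀ p ∈ VertexTori (fun _ : Fin (3 + 1) => κ), ‖B p‖ ≤ Sst)
    (hSs : ∀ p ∈ VertexTori (fun _ : Fin (3 + 1) => κ), ‖C p‖ ≤ Ss)
    (hSt : ∀ p ∈ VertexTori (fun _ : Fin (3 + 1) => κ), ‖D p‖ ≤ St)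
    {N : ℕ} (hN : 1 ≤ N) [NeZero (4 * N)] {t r : ℝ}
    (hT : ‖((code16SetE N).card : ℂ)⁻¹ *
        (∑ w ∈ code16SetE N, descend (fun p => ((A p)⁻¹ * B p).trace - ((A p)⁻¹ * C p * (A (p - c))⁻¹ * D p).trace)
          (gridPt (4 * N) w)) - t‖ ≤ r)
    {A₀ : ℝ} (hA₀ : Fintype.card n * (Ba * Sst + Ba * Ss * Ba * St) * codeTheta (aliasRatioL1 κ N) ≤ A₀) (lo : ℚ)
    (hlo : ((lo : ℚ) : ℝ) ≤ t - r - A₀) : Rows b :=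
  have hF : ∀ q ∈ VertexTori (fun _ : Fin (3 + 1) => κ), (A q).det ≠ 0 :=
    det_ne_zero_vertexTori_of_boxes_negConjRegion hAn hAc ν₀ ν₁ boxes ctr hw hcov hcert
  have hBa : ∀ p ∈ VertexTori (fun _ : Fin (3 + 1) => κ), ‖(A p)⁻¹‖ ≤ Ba :=
    hBa_of_boxes_negConjRegion hAn hAc ν₀ ν₁ boxes ctr hw hcov hcert
  rowsOfOneLoopFormCode16E_routeA₂ (A' := fun p => A (p - c)) hb hκ le_rfl hA hA' hBst hBs hBt
    (MatTubeHol.det_ne_zero_of_vertexTori hA hκ hF hW)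
    (det_sub_ne_zero_of_tube (MatTubeHol.det_ne_zero_tube_of_vertexTori hA hκ hF hW) hc)
    hBa (invNorm_sub_real_le_of_vertexTori hA hBa hc) hSst hSs hSt hN hT hA₀ lo hlo

end Anchor

end

end Summit.QuantumFields.BalabanUV.Beta.CapRouteABoxes
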